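import Mathlib

/-!
# Route `FilamentSkeletonRss` · crux `TransverseReduction1AG` (stmt-NavierStokesRegularity-27853) · line `defect_column_gate_1AG` —
# the m = 2 (quadrupole) radial block of S2a-loc: PRELIMINARIES (the regular homogeneous profile `g` in closed form, its bounds, a kernel)

Helper file (`--supports stmt-NavierStokesRegularity-27853 --as helper`; seat ns-filament-s2aloc-p1 g0).  Companion of
`Theorems/FilamentSkeletonRssDefectColumnGateRadialBlock{Prelim,}.lean` (LEAD 21221-p1 g11: the m = 0 block).  In the variable `u = r²` the
m = 2 Fourier block of the frozen SYMMETRIC sectional operator at `Rc = 0` (pure strain `−(γ/2)ξ`, stretching `γ`) is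
`L₂ w = −(4u w′ + γu w)′ + 4w/u`; m = 2 is the one azimuthal order besides 0 whose homogeneous solutions are elementary: `1/u` (the harmonic zero
mode `1/z̄²` of the symmetric far field) and `g(u)/u` with

  `g(u) = ∫₀^u s e^{−γs/4} ds = (16/γ²)·(1 − e^{−γu/4}(1 + γu/4))`.

This file: the closed form `g` and its derivative `u e^{−γu/4}` (`quadG_hasDerivAt`), `0 ≤ g ≤ u²`, `g ≤ 16/γ²`, the EXACT tail identity
`g(u) + (4/γ)(u + 4/γ)e^{−γu/4} = 16/γ²` (`quadG_add_tail`) — which is what makes the support condition at `u = U` harmless in the block estimate: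
`(g(U) − g(s))·e^{γs/4} ≤ (4/γ)(s + 4/γ)`, no `e^{γU/4}` — monotonicity, the lower bound `g(u) ≥ e^{−γ/4}/2` for `u ≥ 1`, and the kernel antiderivative
`(log(s/(1+s)) + 1/(1+s))′ = 1/(s(1+s)²)` with `log(1 + 1/u) ≤ 1/u`.  HONEST FRAMING: elementary real analysis about one block of one linear MODEL
operator (MODEL rung, negative side); nothing here bears on Navier–Stokes regularity.
-/

set_option linter.dupNamespace false

noncomputable section

namespace Summit.NavierStokesRegularity.NavierStokesRegularity.Theorems.DefectColumnGate

open scoped Topology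
open Set Filter MeasureTheory intervalIntegral

/-! ## 1. The regular m = 2 profile `g(u) = (16/γ²)(1 − e^{−γu/4}(1+γu/4))` -/

/-- `g′(u) = u·e^{−γu/4}` (so `g(u) = ∫₀^u s e^{−γs/4} ds`). -/
theorem quadG_hasDerivAt {γ : ℝ} (hγ : γ ≠ 0) (u : ℝ) :
    HasDerivAt (fun s : ℝ => 16 / γ ^ 2 * (1 - Real.exp (-(γ * s / 4)) * (1 + γ * s / 4)))
      (u * Real.exp (-(γ * u / 4))) u := by
  have h1 : HasDerivAt (fun s : ℝ => -(γ * s / 4)) (-(γ * 1 / 4)) u :=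
    (((hasDerivAt_id' u).const_mul γ).div_const 4).neg
  have h2 : HasDerivAt (fun s : ℝ => Real.exp (-(γ * s / 4))) (Real.exp (-(γ * u / 4)) * (-(γ * 1 / 4))) u :=
    h1.exp
  have h3 : HasDerivAt (fun s : ℝ => 1 + γ * s / 4) (γ * 1 / 4) u :=
    (((hasDerivAt_id' u).const_mul γ).div_const 4).const_add 1
  have h4 := ((h2.mul h3).const_sub 1).const_mul (16 / γ ^ 2)
  refine h4.congr_deriv ?_
  field_simp
  ring

/-- The EXACT tail identity: `g(u) + (4/γ)(u + 4/γ)·e^{−γu/4} = 16/γ²`. -/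
theorem quadG_add_tail {γ : ℝ} (hγ : γ ≠ 0) (u : ℝ) :
    16 / γ ^ 2 * (1 - Real.exp (-(γ * u / 4)) * (1 + γ * u / 4)) + 4 / γ * (u + 4 / γ) * Real.exp (-(γ * u / 4))
      = 16 / γ ^ 2 := by
  field_simp
  ring

/-- `0 ≤ g(u)` for `u ≥ 0` (from `1 + x ≤ eˣ`). -/
theorem quadG_nonneg {γ : ℝ} (hγ : 0 < γ) {u : ℝ} (hu : 0 ≤ u) :
    0 ≤ 16 / γ ^ 2 * (1 - Real.exp (-(γ * u / 4)) * (1 + γ * u / 4)) := by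
  have hx : 0 ≤ γ * u / 4 := by positivity
  have h1 : 1 + γ * u / 4 ≤ Real.exp (γ * u / 4) := Real.add_one_le_exp _ |>.trans_eq' (by ring)
  have h2 : Real.exp (-(γ * u / 4)) * (1 + γ * u / 4) ≤ 1 := by
    rw [Real.exp_neg, inv_mul_le_iff₀ (Real.exp_pos _), mul_one]
    exact h1
  have : 0 ≤ 1 - Real.exp (-(γ * u / 4)) * (1 + γ * u / 4) := sub_nonneg.mpr h2
  positivity

/-- `g(u) ≤ u²` for `u ≥ 0` (from `1 − x ≤ e^{−x}`: `e^{−x}(1+x) ≥ 1 − x²`). -/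
theorem quadG_le_sq {γ : ℝ} (hγ : 0 < γ) {u : ℝ} (hu : 0 ≤ u) :
    16 / γ ^ 2 * (1 - Real.exp (-(γ * u / 4)) * (1 + γ * u / 4)) ≤ u ^ 2 := by
  set x : ℝ := γ * u / 4 with hxdef
  have hx : 0 ≤ x := by positivity
  have h1 : 1 - x ≤ Real.exp (-x) := by
    have := Real.add_one_le_exp (-x)
    linarith
  have h2 : 1 - x ^ 2 ≤ Real.exp (-x) * (1 + x) := by
    have h1x : 0 ≤ 1 + x := by linarith
    calc 1 - x ^ 2 = (1 - x) * (1 + x) := by ring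
      _ ≤ Real.exp (-x) * (1 + x) := mul_le_mul_of_nonneg_right h1 h1x
  have h3 : 1 - Real.exp (-x) * (1 + x) ≤ x ^ 2 := by linarith
  have hγ2 : 0 < 16 / γ ^ 2 := by positivity
  calc 16 / γ ^ 2 * (1 - Real.exp (-x) * (1 + x)) ≤ 16 / γ ^ 2 * x ^ 2 := mul_le_mul_of_nonneg_left h3 hγ2.le
    _ = u ^ 2 := by rw [hxdef]; field_simp; ring

/-- `g(u) ≤ 16/γ²` for `u ≥ 0`. -/
theorem quadG_le_sup {γ : ℝ} (hγ : 0 < γ) {u : ℝ} (hu : 0 ≤ u) :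
    16 / γ ^ 2 * (1 - Real.exp (-(γ * u / 4)) * (1 + γ * u / 4)) ≤ 16 / γ ^ 2 := by
  have h : 0 ≤ Real.exp (-(γ * u / 4)) * (1 + γ * u / 4) := by positivity
  have hγ2 : 0 < 16 / γ ^ 2 := by positivity
  nlinarith

/-- Tail comparison: for `u ≤ U`, `g(U) − g(u) ≤ (4/γ)(u + 4/γ)e^{−γu/4}` (the tail at `U` is nonnegative). -/
theorem quadG_sub_le {γ : ℝ} (hγ : 0 < γ) {u U : ℝ} (hU : 0 ≤ U) :
    16 / γ ^ 2 * (1 - Real.exp (-(γ * U / 4)) * (1 + γ * U / 4))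
      - 16 / γ ^ 2 * (1 - Real.exp (-(γ * u / 4)) * (1 + γ * u / 4))
      ≤ 4 / γ * (u + 4 / γ) * Real.exp (-(γ * u / 4)) := by
  have hU' := quadG_add_tail hγ.ne' U
  have hu' := quadG_add_tail hγ.ne' u
  have htail : 0 ≤ 4 / γ * (U + 4 / γ) * Real.exp (-(γ * U / 4)) := by positivity
  linarith

/-- `g` is monotone on `[0, ∞)`: `u ≤ U ⇒ g(u) ≤ g(U)` (its derivative `u e^{−γu/4}` is nonnegative there). -/
theorem quadG_mono {γ : ℝ} (hγ : 0 < γ) {u U : ℝ} (hu : 0 ≤ u) (huU : u ≤ U) :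
    16 / γ ^ 2 * (1 - Real.exp (-(γ * u / 4)) * (1 + γ * u / 4))
      ≤ 16 / γ ^ 2 * (1 - Real.exp (-(γ * U / 4)) * (1 + γ * U / 4)) := by
  have hmono : MonotoneOn (fun s : ℝ => 16 / γ ^ 2 * (1 - Real.exp (-(γ * s / 4)) * (1 + γ * s / 4))) (Ici 0) := by
    apply monotoneOn_of_deriv_nonneg (convex_Ici 0)
    · exact (HasDerivAt.continuousOn fun s _ => quadG_hasDerivAt hγ.ne' s)
    · intro s _
      exact (quadG_hasDerivAt hγ.ne' s).differentiableAt.differentiableWithinAt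
    · intro s hs
      rw [interior_Ici] at hs
      rw [(quadG_hasDerivAt hγ.ne' s).deriv]
      exact mul_nonneg (le_of_lt hs) (Real.exp_pos _).le
  exact hmono hu (hu.trans huU) huU

/-- Lower bound at `u = 1` (hence, by monotonicity, for all `u ≥ 1`): `g(1) ≥ e^{−γ/4}/2` (from `1 + x + x²/2 ≤ eˣ`). -/
theorem quadG_one_ge {γ : ℝ} (hγ : 0 < γ) :
    Real.exp (-(γ / 4)) / 2 ≤ 16 / γ ^ 2 * (1 - Real.exp (-(γ * 1 / 4)) * (1 + γ * 1 / 4)) := by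
  set x : ℝ := γ / 4 with hxdef
  have hx : 0 ≤ x := by positivity
  have hq : 1 + x + x ^ 2 / 2 ≤ Real.exp x := Real.quadratic_le_exp_of_nonneg hx
  have hpos : 0 < Real.exp x := Real.exp_pos x
  -- e^{-x}(1+x) ≤ 1 - e^{-x} x²/2
  have h1 : Real.exp (-x) * (1 + x) + Real.exp (-x) * (x ^ 2 / 2) ≤ 1 := by
    rw [← mul_add, Real.exp_neg, inv_mul_le_iff₀ hpos, mul_one]
    linarith
  have hγx : γ * 1 / 4 = x := by rw [hxdef]; ring
  rw [hγx]
  have h16 : 16 / γ ^ 2 = 1 / x ^ 2 := by rw [hxdef]; field_simp; ring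
  rw [h16]
  have hx0 : 0 < x := by positivity
  rw [div_mul_eq_mul_div, one_mul, le_div_iff₀ (by positivity)]
  nlinarith [Real.exp_pos (-x)]

/-- For `1 ≤ U`: `g(U) ≥ e^{−γ/4}/2 > 0`. -/
theorem quadG_ge_of_one_le {γ : ℝ} (hγ : 0 < γ) {U : ℝ} (hU : 1 ≤ U) :
    Real.exp (-(γ / 4)) / 2 ≤ 16 / γ ^ 2 * (1 - Real.exp (-(γ * U / 4)) * (1 + γ * U / 4)) :=
  (quadG_one_ge hγ).trans (quadG_mono hγ zero_le_one hU)

/-! ## 2. A kernel antiderivative and two logarithm bounds -/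

/-- `(log(s/(1+s)) + 1/(1+s))′ = 1/(s(1+s)²)` for `s > 0`. -/
theorem kernel_log_hasDerivAt {s : ℝ} (hs : 0 < s) :
    HasDerivAt (fun t : ℝ => Real.log (t / (1 + t)) + 1 / (1 + t)) (1 / (s * (1 + s) ^ 2)) s := by
  have h1s : (1 + s) ≠ 0 := by linarith
  have hq : HasDerivAt (fun t : ℝ => t / (1 + t)) (((1 : ℝ) * (1 + s) - s * 1) / (1 + s) ^ 2) s := by
    exact (hasDerivAt_id' s).div ((hasDerivAt_id' s).const_add 1) h1s
  have hqpos : s / (1 + s) ≠ 0 := by positivity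
  have hlog := hq.log hqpos
  have hinv : HasDerivAt (fun t : ℝ => 1 / (1 + t)) (((0 : ℝ) * (1 + s) - 1 * 1) / (1 + s) ^ 2) s :=
    (hasDerivAt_const s (1 : ℝ)).div ((hasDerivAt_id' s).const_add 1) h1s
  refine (hlog.add hinv).congr_deriv ?_
  field_simp
  ring

/-- `log(1 + 1/u) ≤ 1/u` for `u > 0`, in the form `−log(u/(1+u)) ≤ 1/u`. -/
theorem neg_log_div_le {u : ℝ} (hu : 0 < u) : -Real.log (u / (1 + u)) ≤ 1 / u := by
  have h1 : u / (1 + u) = (1 + 1 / u)⁻¹ := by field_simp; ring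
  rw [h1, Real.log_inv, neg_neg]
  have := Real.log_le_sub_one_of_pos (show 0 < 1 + 1 / u by positivity)
  linarith

/-- For `0 < s`: `log(s/(1+s)) + 1/(1+s) ≤ 0` (the antiderivative above increases to `0` at infinity). -/
theorem kernel_log_nonpos {s : ℝ} (hs : 0 < s) : Real.log (s / (1 + s)) + 1 / (1 + s) ≤ 0 := by
  -- log(s/(1+s)) = -log(1 + 1/s) ≤ -( (1/s) / (1 + 1/s) ) = -1/(1+s)   [log(1+y) ≥ y/(1+y)]
  have hy : 0 < 1 / s := by positivity
  have h1 : s / (1 + s) = (1 + 1 / s)⁻¹ := by field_simp; ring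
  have hlog : Real.log (1 + 1 / s) ≥ (1 / s) / (1 + 1 / s) := by
    -- from log x ≥ 1 - 1/x at x = 1 + 1/s
    have h := Real.one_sub_inv_le_log_of_pos (show 0 < 1 + 1 / s by positivity)
    have : (1 / s) / (1 + 1 / s) = 1 - (1 + 1 / s)⁻¹ := by field_simp; ring
    rw [this]; exact h
  have h2 : (1 / s) / (1 + 1 / s) = 1 / (1 + s) := by field_simp; ring
  rw [h1, Real.log_inv]
  linarith [hlog.le, h2.symm.le, h2.le]

end Summit.NavierStokesRegularity.NavierStokesRegularity.Theorems.DefectColumnGate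

end
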